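import Summits.QuantumFields.BalabanUV.T4Continuum.Spine.NE1p.DressedSourceAnalyticOnCores

/-!
# T⁴ programme, spine estimate NE1′ (node O3b/H2) — THE (2.14)-FORMAT TERMS ARE JOINTLY HOLOMORPHIC IN (OPERATOR DATUM, TABLE):
# row NE5's displayed `TermLineAnalytic` for core families is a THEOREM of the Gaussian letters, and the dressed small-field output
# built from cores is JOINTLY holomorphic in (operator datum, source) — N0n's joint (source, background) face with (B1a) DISCHARGED
# in BOTH species

Cell `pub-balaban`, sub-cell `t4`, BINDER-OWNERS row NE1′; NE1′ formalisation crew, unit `b2b-balaban-t4-ne1p-formalise-leaf-03`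
(LEAF PROVER 03, generation 12); crew row S⟨next⟩ of `t4/formal/NE1p/LEAVES.md` (follower of the unit's own S33 in its own scope).
ADDITIVE — imports S33 `Spine/NE1p/DressedSourceAnalyticOnCores` ONLY (→ N0r → N0q → N0p → row NE5's `B13TermParamGaussianBi{,Prod}` ∕
`OutputRateGaussianParamBi` ∕ `OutputRateOpGaussianParam`, N0n `DressedOutputAnalytic`, the Literature shape module
`T4InputCauchyRateTermwise`); THEOREMS ONLY (0 def, 0 `def … : Prop`, 0 cite); nothing of those modules is restated.

WHY THIS FILE.  Row NE5 PROVED for the cell's (2.14)-format cores (`BiCore`, `termAt`∕`termBi`) holomorphy in the OPERATOR datum at a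
FIXED table (`OutputRateOpGaussianParam.differentiableOn_paramGaussianTerm` ⇒ `termOpLineAnalytic_of_gaussianParam`) and the
history species at a FIXED operator datum (`termHistExpLinear_of_bi`: entire in the table), from the Gaussian letters `hm`∕`hN`∕`hq`;
N0p∕S33 used the second to discharge (E1)∕(E2) along table maps.  The JOINT statement — row NE5's displayed hypothesis shape
`T4InputCauchyRateTermwise.TermLineAnalytic` («along every complex segment `ζ ↦ (o + ζu, h + ζv)` … EVERY TERM is complex
differentiable», a binder `hline` of NE5's ENDs) — was not in the tree for core families, nor was N0n's joint (source, background) face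
`differentiableOn_locE_source_background` available with (E1) discharged when the background moves the operator datum.  Observation:
NE5's operator lemma is stated over an ARBITRARY complex normed operator space, so it applies to the product space `Op × Hist` with the
exponent `q(o, p, v) − readOut(p, v)·h` (holomorphic in `(o, h)`, affine margin `m‖v‖² − (b + N₁·R_H)` on a bounded table ball) and the
table-free insertion `chi`:
* §1 `differentiableOn_termAt_joint` — ONE core's term `(o, h) ↦ termAt o h` is (Fréchet-) complex differentiable on `𝒪 ×ˢ ball 0 R_H`
  for every open operator set `𝒪` carrying the letters and every table radius `R_H` (NE5's `differentiableOn_paramGaussianTerm` ONCE BY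
  NAME on `Op × B13HistM P`; the two integrands agree by `exp (r − q) = exp r · exp (−q)`).
* §2 `termLineAnalytic_termAt` — **row NE5's `TermLineAnalytic (ballClass ctr ROp RHist)` HOLDS for every family of cores with
  TERM-DEPENDENT polymer families** under the letters `hm`∕`hN`∕`hq` on the open operator ball and the room `ROp < R′` (§1 composed with
  the affine segment; the room puts the closed unit segment inside the open letter ball).
* §3 (E2) along a map moving BOTH arguments: `norm_term_biparam_le` ∕ `norm_act_le_of_terms_biparam` (S33 §1's (E2) VERBATIM with the
  operator datum also read along the parameter — `TermHistExpLinear` quantifies over class points, so the proof is unchanged).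
* §4 `analytic_and_bounded_locE_opSource_of_coresAt_pencil_mass` — N0n's `analytic_and_bounded_locE_param` ONCE BY NAME at the parameter
  space `Op × ℂ`, open set `ball (ctr k g U).1 (ROp k) ×ˢ ball 0 μ₁`: the dressed small-field output of cores along the SOURCE pencil
  `h₀ + s • v` is JOINTLY complex differentiable in (operator datum, source) and bounded by the (2.41) envelope — (E1) by §1 in both
  species, (E2) by §3 + N0q's letter budget `hM3` (`norm_integral_coreDensity_le`, o-UNIFORM on the letter ball); binders = S33 §3's with
  `hO` DROPPED (the operator datum is now a variable of the open class ball).  At the substrate's slot: §5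
  `analytic_and_bounded_locE_opSource_of_actOfLetters` (`hact` by `rfl`).

HONEST FRAMING.  (B1a) in BOTH species is hereby kernel for the cell's (2.14)-FORMAT — a relocation onto the Gaussian LETTER hypotheses
`hN`∕`hq` (holomorphy ∕ bounds ∕ affine margin of the substrate's displayed tables on the operator ball; rows NE2∕NE3's data as row NE5
displays them), NOT onto Bałaban's (2.14): row NE5's wall line «`OpFibreEnvelope`∕`TermLineAnalytic` of the (2.14)-terms» concerns the
IDENTIFICATION of Bałaban's resummed terms with such cores — the substrate's DISPLAYED reading, NOT claimed here; (B1b)'s residue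
(`terms`∕`emb`∕`hscale`), (B3) = `hM3` (G-ne9p2-5 UNPRINTED, shared with NE9), the clause SHAPES and `hH` stay DISPLAYED; no numeral of
print; 0 binders instantiated on Bałaban's densities; no wall item of NE1′ or NE5 moves; wall v1.7 (T4-DAG v43) does NOT move; R-t4r2-Q2
NOT met.  NE1′ ⇐ the named binders — NOT proved, NOT printed; spine PROVED 0∕9; count 9 unchanged.  Rung (B)+1 on ONE finite four-torus —
NOT infinite volume, NOT a mass gap, NOT OS on ℝ⁴, NOT Clay.  HONEST DEPENDENCY: continuum YM on T⁴ ⇐ BetaPertH ∧ nine spine estimates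
(0/9 proved); BetaPertH ⇐ (D1) ∧ (D4) ∧ CAP+tail; G-an2-4 gates asym, D1 and NE2/3/4.
-/

noncomputable section

namespace Summit.QuantumFields.BalabanUV.T4Continuum.NE1p.DressedJointAnalyticOnCores

open Metric Set Complex MeasureTheory
open scoped BigOperators
open Literature.MathematicalPhysics.QuantumFieldTheory.Balaban1983to89 (LocDomainSys)
open Literature.MathematicalPhysics.QuantumFieldTheory.Balaban1983to89.T4OutputRate (Carriers)
open Literature.MathematicalPhysics.QuantumFieldTheory.Balaban1983to89.B13Resummation (locE Geometry)
open Literature.MathematicalPhysics.QuantumFieldTheory.Balaban1983to89.T4InputCauchyRateSpecies (ballClass)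
open Literature.MathematicalPhysics.QuantumFieldTheory.Balaban1983to89.T4InputCauchyRateTermwise (TermHistExpLinear TermLineAnalytic
  norm_integral_mul_cexp_clm_le)
open Summit.QuantumFields.BalabanUV.T4Continuum.B13HistMeasurable (MeasPotFrame B13HistM)
open Summit.QuantumFields.BalabanUV.T4Continuum.B13TermParamGaussianBi (BiCore)
open Summit.QuantumFields.BalabanUV.T4Continuum.OutputRateOpGaussianParam (differentiableOn_paramGaussianTerm)
open Summit.QuantumFields.BalabanUV.T4Continuum.SubstrateActivities (CoreLetters coreOf actOfLetters)
open Summit.QuantumFields.BalabanUV.T4Continuum.NE1p.DressedOutputAnalytic (analytic_and_bounded_locE_param)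
open Summit.QuantumFields.BalabanUV.T4Continuum.NE1p.DressedSmallFieldOnCores (norm_pencil_le)
open Summit.QuantumFields.BalabanUV.T4Continuum.NE1p.DressedSmallFieldOnCoresMass (norm_integral_coreDensity_le)
open Summit.QuantumFields.BalabanUV.T4Continuum.NE1p.DressedSmallFieldOnCoresSlot (termHistExpLinear_termAt)

/-! ## §1 ONE CORE'S TERM IS JOINTLY HOLOMORPHIC IN (OPERATOR DATUM, TABLE) -/

section Joint

variable {C : Carriers} {P : MeasPotFrame C} {𝒴 : Type*} {dom : 𝒴 → C.Dom} {Op : Type*} [NormedAddCommGroup Op]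
  [NormedSpace ℂ Op] {PΛ : Type*} [MeasurableSpace PΛ] {V : Type*} [NormedAddCommGroup V] [InnerProductSpace ℝ V]
  [FiniteDimensional ℝ V] [MeasurableSpace V] [BorelSpace V]

/-- **THE (2.14)-FORMAT TERM IS JOINTLY HOLOMORPHIC IN (OPERATOR DATUM, TABLE)** (kernel; row NE5's
`OutputRateOpGaussianParam.differentiableOn_paramGaussianTerm` ONCE BY NAME on the product space `Op × B13HistM P` with the open set
`𝒪 ×ˢ ball 0 R_H`, normalisation `N(o, p)`, table-free insertion `chi v` (growth constant `1`) and exponent `q(o, p, v) − readOut(p, v)·h`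
— holomorphic in `(o, h)`, jointly measurable, affine margin `m‖v‖² − (b + N₁·R_H)` on the table ball): for every open operator set `𝒪`
carrying the Gaussian letters (`N(o, ·)` measurable, `N(·, p)` holomorphic, `‖N‖ ≤ N₀`; `q(o, ·, ·)` jointly measurable, `q(·, p, v)`
holomorphic, `m‖v‖² − b ≤ Re q`, `0 < m`) and every table radius `R_H`, `(o, h) ↦ termAt o h` is complex differentiable on
`𝒪 ×ˢ ball 0 R_H`. [folklore] -/
theorem differentiableOn_termAt_joint (𝔠 : BiCore P dom Op PΛ V) {𝒪 : Set Op} (h𝒪 : IsOpen 𝒪) {m b N₀ : ℝ} (hm : 0 < m)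
    (hN_meas : ∀ o ∈ 𝒪, AEStronglyMeasurable (𝔠.N o) 𝔠.lam) (hN_hol : ∀ p, DifferentiableOn ℂ (fun o => 𝔠.N o p) 𝒪)
    (hN : ∀ o ∈ 𝒪, ∀ p, ‖𝔠.N o p‖ ≤ N₀)
    (hq_meas : ∀ o ∈ 𝒪, AEStronglyMeasurable (Function.uncurry (𝔠.q o)) (𝔠.lam.prod volume))
    (hq_hol : ∀ p v, DifferentiableOn ℂ (fun o => 𝔠.q o p v) 𝒪)
    (hq_re : ∀ o ∈ 𝒪, ∀ p v, m * ‖v‖ ^ 2 - b ≤ (𝔠.q o p v).re) (RH : ℝ) :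
    DifferentiableOn ℂ (fun z : Op × B13HistM P => 𝔠.termAt z.1 z.2) (𝒪 ×ˢ ball (0 : B13HistM P) RH) := by
  haveI := 𝔠.finite
  have hO' : IsOpen (𝒪 ×ˢ ball (0 : B13HistM P) RH) := h𝒪.prod isOpen_ball
  have h := (differentiableOn_paramGaussianTerm (Op := Op × B13HistM P) (lam := 𝔠.lam) (w := 𝔠.w)
    (N := fun z p => 𝔠.N z.1 p) (g := fun _ v => 𝔠.chi v) (q := fun z p v => 𝔠.q z.1 p v - 𝔠.readOut p v z.2)
    (w₀ := 𝔠.wB) (N₀ := N₀) (G₀ := 1) (m := m) (b := b + 𝔠.N₁ * RH) hO' hm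
    𝔠.measW.aestronglyMeasurable 𝔠.norm_w_le (fun z hz => hN_meas z.1 hz.1)
    (fun p => (hN_hol p).comp differentiableOn_fst fun z hz => hz.1) (fun z hz p => hN z.1 hz.1 p)
    ((𝔠.measurable_chi.comp measurable_snd).aestronglyMeasurable)
    (fun p v => by rw [one_mul]; exact (𝔠.norm_chi_le_one v).trans (Real.one_le_exp (by positivity)))
    (fun z hz => (hq_meas z.1 hz.1).sub (𝔠.measurable_readOut_apply z.2).aestronglyMeasurable)
    (fun p v => ((hq_hol p v).comp differentiableOn_fst fun z hz => hz.1).sub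
      ((𝔠.readOut p v).differentiable.comp differentiable_snd).differentiableOn)
    (fun z hz p v => by
      have h1 := hq_re z.1 hz.1 p v
      have h2 : ‖𝔠.readOut p v z.2‖ ≤ 𝔠.N₁ * RH :=
        (ContinuousLinearMap.le_opNorm _ _).trans
          (mul_le_mul (𝔠.norm_readOut_le p v) (le_of_lt (mem_ball_zero_iff.1 hz.2)) (norm_nonneg _) 𝔠.N₁_nonneg)
      have h3 := abs_le.1 ((Complex.abs_re_le_norm (𝔠.readOut p v z.2)).trans h2)
      rw [Complex.sub_re]
      linarith [h3.2])).1
  refine h.congr fun z _ => ?_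
  show 𝔠.termAt z.1 z.2 = _
  unfold BiCore.termAt
  refine integral_congr_ae (Filter.Eventually.of_forall fun p => ?_)
  show 𝔠.w p * 𝔠.N z.1 p * _ = 𝔠.w p * 𝔠.N z.1 p * _
  congr 1
  refine integral_congr_ae (Filter.Eventually.of_forall fun v => ?_)
  show 𝔠.chi v * cexp (𝔠.readOut p v z.2) * cexp (-𝔠.q z.1 p v) = 𝔠.chi v * cexp (-(𝔠.q z.1 p v - 𝔠.readOut p v z.2))
  rw [neg_sub, sub_eq_add_neg, Complex.exp_add, mul_assoc]

end Joint

/-! ## §2 ROW NE5's `TermLineAnalytic` HOLDS FOR CORE FAMILIES WITH TERM-DEPENDENT POLYMER FAMILIES -/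

section Line

variable {C : Carriers} {P : MeasPotFrame C} {Op : Type*} [NormedAddCommGroup Op] [NormedSpace ℂ Op] {ι : Type*}
  {𝒴 : ℕ → ι → Type*} {dom : ∀ k i, 𝒴 k i → C.Dom} {β : ℕ → ι → Type*} [∀ k i, MeasurableSpace (β k i)]
  {α : ℕ → ι → Type*} [∀ k i, NormedAddCommGroup (α k i)] [∀ k i, InnerProductSpace ℝ (α k i)]
  [∀ k i, FiniteDimensional ℝ (α k i)] [∀ k i, MeasurableSpace (α k i)] [∀ k i, BorelSpace (α k i)]

/-- **`TermLineAnalytic` FOR THE CORES' TERMS** (kernel; §1 at `𝒪 := ball (ctr k g U).1 (R′ k)`, table radius `‖h‖ + ‖v‖ + 1`,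
composed with the affine segment `ζ ↦ (o + ζ • u, h + ζ • v)`: a segment whose closed unit part lies in the ball class has its operator
part in the CLOSED ball of radius `ROp k`, hence — by the room `ROp k < R′ k` — inside the OPEN letter ball, where §1 gives Fréchet
differentiability; row NE5's displayed binder `hline : TermLineAnalytic (ballClass ctr ROp RHist) T W` of its ENDs is thereby a THEOREM
for `T := fun k i o h X => (𝔊 k i X).termAt o h` under the letters of `termGaussianParamBi_termBi` ∕ N0r's `termHistExpLinear_termAt`).
[folklore] -/
theorem termLineAnalytic_termAt {W : Set (ℕ → ℝ)} {ctr : ℕ → (ℕ → ℝ) → C.BgB → Op × B13HistM P} {ROp RHist R' : ℕ → ℝ}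
    (𝔊 : ∀ k i, C.Dom → BiCore P (dom k i) Op (β k i) (α k i)) {m b N₀ : ℕ → ι → C.Dom → ℝ} (hroom : ∀ k, ROp k < R' k)
    (hm : ∀ k, ∀ g ∈ W, ∀ (U : C.BgB) (X : C.Dom), C.scale X = k → ∀ i, 0 < m k i X)
    (hN : ∀ k, ∀ g ∈ W, ∀ (U : C.BgB) (X : C.Dom), C.scale X = k → ∀ i,
      (∀ o ∈ ball (ctr k g U).1 (R' k), AEStronglyMeasurable ((𝔊 k i X).N o) (𝔊 k i X).lam) ∧
      (∀ p, DifferentiableOn ℂ (fun o => (𝔊 k i X).N o p) (ball (ctr k g U).1 (R' k))) ∧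
      (∀ o ∈ ball (ctr k g U).1 (R' k), ∀ p, ‖(𝔊 k i X).N o p‖ ≤ N₀ k i X))
    (hq : ∀ k, ∀ g ∈ W, ∀ (U : C.BgB) (X : C.Dom), C.scale X = k → ∀ i,
      (∀ o ∈ ball (ctr k g U).1 (R' k),
        AEStronglyMeasurable (Function.uncurry ((𝔊 k i X).q o)) ((𝔊 k i X).lam.prod volume)) ∧
      (∀ p v, DifferentiableOn ℂ (fun o => (𝔊 k i X).q o p v) (ball (ctr k g U).1 (R' k))) ∧
      (∀ o ∈ ball (ctr k g U).1 (R' k), ∀ p v, m k i X * ‖v‖ ^ 2 - b k i X ≤ ((𝔊 k i X).q o p v).re)) :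
    TermLineAnalytic (ballClass ctr ROp RHist) (fun k i o h X => (𝔊 k i X).termAt o h) W := by
  intro k g hg U o u h v hseg X hX i ζ hζ
  obtain ⟨hNm, hNh, hNb⟩ := hN k g hg U X hX i
  obtain ⟨hqm, hqh, hqre⟩ := hq k g hg U X hX i
  have hjoint := differentiableOn_termAt_joint (𝔊 k i X) isOpen_ball (hm k g hg U X hX i) hNm hNh hNb hqm hqh hqre
    (‖h‖ + ‖v‖ + 1)
  have hmem : (o + ζ • u, h + ζ • v) ∈ ball (ctr k g U).1 (R' k) ×ˢ ball (0 : B13HistM P) (‖h‖ + ‖v‖ + 1) := by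
    refine Set.mk_mem_prod (mem_ball.2 (lt_of_le_of_lt (mem_closedBall.1 (hseg ζ hζ).1) (hroom k))) ?_
    rw [mem_ball_zero_iff]
    have hζ1 : ‖ζ‖ ≤ 1 := mem_closedBall_zero_iff.1 hζ
    calc ‖h + ζ • v‖ ≤ ‖h‖ + ‖ζ‖ * ‖v‖ := (norm_add_le _ _).trans (by rw [norm_smul])
      _ ≤ ‖h‖ + 1 * ‖v‖ := by gcongr
      _ < ‖h‖ + ‖v‖ + 1 := by linarith
  have hA : DifferentiableAt ℂ (fun ζ : ℂ => (o + ζ • u, h + ζ • v)) ζ :=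
    ((differentiableAt_const o).add (differentiableAt_id.smul_const u)).prodMk
      ((differentiableAt_const h).add (differentiableAt_id.smul_const v))
  exact ((hjoint.differentiableAt ((isOpen_ball.prod isOpen_ball).mem_nhds hmem)).comp ζ hA).differentiableWithinAt

end Line

/-! ## §3 (E2) ALONG A PARAMETER MOVING BOTH THE OPERATOR DATUM AND THE TABLE -/

section BiParam

variable {C : Carriers} {Op Hist : Type*} [NormedAddCommGroup Hist] [NormedSpace ℂ Hist] {ι : Type*}
  {K : ℕ → (ℕ → ℝ) → C.BgB → Set (Op × Hist)} {T : ℕ → ι → Op → Hist → C.Dom → ℂ}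
  {W : Set (ℕ → ℝ)} {α : ℕ → ι → Type*} [∀ k i, MeasurableSpace (α k i)] {μ : ∀ k i, Op → C.Dom → Measure (α k i)}
  {Φ : ∀ k i, Op → C.Dom → α k i → ℂ} {Λ : ∀ k i, Op → C.Dom → α k i → (Hist →L[ℂ] ℂ)} {Q : Type*}

/-- **(E2) PER TERM ALONG A MAP MOVING BOTH ARGUMENTS** (kernel; S33's `norm_term_param_le` VERBATIM with the operator datum `ho p`
also read along the parameter — `TermHistExpLinear` quantifies over class points): `‖T k i (ho p) (hc p) X‖ ≤ (∫‖Φ k i (ho p) X‖)·e^{N·R₀}`.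
[folklore] -/
theorem norm_term_biparam_le (hexp : TermHistExpLinear K T W μ Φ Λ) {k : ℕ} {g : ℕ → ℝ} (hg : g ∈ W) {U : C.BgB}
    {ho : Q → Op} {hc : Q → Hist} {S : Set Q} (hK : ∀ p ∈ S, (ho p, hc p) ∈ K k g U) {R₀ : ℝ} (hR : ∀ p ∈ S, ‖hc p‖ ≤ R₀)
    {X : C.Dom} (hX : C.scale X = k) (i : ι) {N : ℝ} (hN0 : 0 ≤ N)
    (hN : ∀ p ∈ S, ∀ᵐ a ∂μ k i (ho p) X, ‖Λ k i (ho p) X a‖ ≤ N) {p : Q} (hp : p ∈ S) :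
    ‖T k i (ho p) (hc p) X‖ ≤ (∫ a, ‖Φ k i (ho p) X a‖ ∂μ k i (ho p) X) * Real.exp (N * R₀) := by
  obtain ⟨hΦ, -, -, hrep⟩ := hexp k g hg U (ho p, hc p) (hK p hp) X hX i
  have hrep' : T k i (ho p) (hc p) X = ∫ a, Φ k i (ho p) X a * cexp (Λ k i (ho p) X a (hc p)) ∂μ k i (ho p) X := hrep
  rw [hrep']
  exact (norm_integral_mul_cexp_clm_le hΦ (hN p hp) (hc p)).trans (mul_le_mul_of_nonneg_left
    (Real.exp_le_exp.2 (mul_le_mul_of_nonneg_left (hR p hp) hN0)) (integral_nonneg fun _ => norm_nonneg _))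

variable {Dom : Type*} {emb : Dom → C.Dom} {terms : Dom → Finset ι} {act : Q → Dom → ℂ}

/-- **(E2) FOR THE ACTIVITIES ALONG A MAP MOVING BOTH ARGUMENTS** (kernel; §3 summed, with a PARAMETER-FREE termwise mass `M Z i`
dominating `∫‖Φ k i (ho p) (emb Z)‖` on `S` — for cores the o-uniform LETTER mass): `‖act p Z‖ ≤ Σ_{i ∈ terms Z} M Z i·e^{N Z i·R₀}`.
[folklore] -/
theorem norm_act_le_of_terms_biparam (hexp : TermHistExpLinear K T W μ Φ Λ) {k : ℕ} {g : ℕ → ℝ} (hg : g ∈ W) {U : C.BgB}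
    {ho : Q → Op} {hc : Q → Hist} {S : Set Q} (hK : ∀ p ∈ S, (ho p, hc p) ∈ K k g U) {R₀ : ℝ} (hR : ∀ p ∈ S, ‖hc p‖ ≤ R₀)
    (hscale : ∀ Z, C.scale (emb Z) = k) (hact : ∀ p ∈ S, ∀ Z, act p Z = ∑ i ∈ terms Z, T k i (ho p) (hc p) (emb Z))
    {N : Dom → ι → ℝ} (hN0 : ∀ Z i, 0 ≤ N Z i)
    (hN : ∀ p ∈ S, ∀ Z, ∀ i ∈ terms Z, ∀ᵐ a ∂μ k i (ho p) (emb Z), ‖Λ k i (ho p) (emb Z) a‖ ≤ N Z i)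
    {M : Dom → ι → ℝ} (hM : ∀ p ∈ S, ∀ Z, ∀ i ∈ terms Z, ∫ a, ‖Φ k i (ho p) (emb Z) a‖ ∂μ k i (ho p) (emb Z) ≤ M Z i)
    {p : Q} (hp : p ∈ S) (Z : Dom) :
    ‖act p Z‖ ≤ ∑ i ∈ terms Z, M Z i * Real.exp (N Z i * R₀) := by
  rw [hact p hp Z]
  refine (norm_sum_le _ _).trans (Finset.sum_le_sum fun i hi => ?_)
  exact (norm_term_biparam_le hexp hg hK hR (hscale Z) i (hN0 Z i) (fun p hp => hN p hp Z i hi) hp).trans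
    (mul_le_mul_of_nonneg_right (hM p hp Z i hi) (Real.exp_pos _).le)

end BiParam

/-! ## §4 THE DRESSED OUTPUT OF CORES IS JOINTLY HOLOMORPHIC IN (OPERATOR DATUM, SOURCE), (B1a) DISCHARGED IN BOTH SPECIES -/

section Dep

variable {C : Carriers} {P : MeasPotFrame C} {Op : Type*} [NormedAddCommGroup Op] [NormedSpace ℂ Op] {ι : Type*}
  {𝒴 : ℕ → ι → Type*} {dom : ∀ k i, 𝒴 k i → C.Dom} {β : ℕ → ι → Type*} [∀ k i, MeasurableSpace (β k i)]
  {α : ℕ → ι → Type*} [∀ k i, NormedAddCommGroup (α k i)] [∀ k i, InnerProductSpace ℝ (α k i)]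
  [∀ k i, FiniteDimensional ℝ (α k i)] [∀ k i, MeasurableSpace (α k i)] [∀ k i, BorelSpace (α k i)]
variable (D : LocDomainSys) {Cube : Type} [DecidableEq Cube] (G : Geometry D Cube)

open Classical in
/-- **JOINT HOLOMORPHY IN (OPERATOR DATUM, SOURCE) + THE (2.41) ENVELOPE FOR CORES WITH TERM-DEPENDENT POLYMER FAMILIES, (B3) AS A
LETTER BUDGET** (kernel; N0n `analytic_and_bounded_locE_param` ONCE BY NAME at the parameter space `Op × ℂ` and the open set
`ball (ctr k g U).1 (ROp k) ×ˢ ball 0 μ₁`, geometry fed from `G` as N0o; (E1) by §1 composed with `p ↦ (p.1, h₀ + p.2 • v)`; (E2) by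
§3 with `hexp := termHistExpLinear_termAt` at the class points `(p.1, h₀ + p.2 • v)` and the o-UNIFORM letter mass from N0q's
`norm_integral_coreDensity_le`; `hL3` = the letter budget **`hM3`**).  Binders = S33 §3's `analytic_and_bounded_locE_of_coresAt_pencil_mass`
WITHOUT `hO` (the operator datum ranges over the open class ball).  Conclusion: `(o, s) ↦ E[Σ_i termAt o (h₀ + s • v)](X₀)` is complex
differentiable on `ball (ctr k g U).1 (ROp k) ×ˢ ball 0 μ₁` and bounded there by `e·ν·c₁·K₀²·A·e^{−r₁ d(X₀)}`. [folklore] -/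
theorem analytic_and_bounded_locE_opSource_of_coresAt_pencil_mass {W : Set (ℕ → ℝ)}
    {ctr : ℕ → (ℕ → ℝ) → C.BgB → Op × B13HistM P} {ROp RHist R' : ℕ → ℝ}
    (𝔊 : ∀ k i, C.Dom → BiCore P (dom k i) Op (β k i) (α k i)) {mq bq N₀ : ℕ → ι → C.Dom → ℝ} (hroom : ∀ k, ROp k < R' k)
    (hm : ∀ k, ∀ g ∈ W, ∀ (U : C.BgB) (X : C.Dom), C.scale X = k → ∀ i, 0 < mq k i X)
    (hN : ∀ k, ∀ g ∈ W, ∀ (U : C.BgB) (X : C.Dom), C.scale X = k → ∀ i,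
      (∀ o ∈ ball (ctr k g U).1 (R' k), AEStronglyMeasurable ((𝔊 k i X).N o) (𝔊 k i X).lam) ∧
      (∀ p, DifferentiableOn ℂ (fun o => (𝔊 k i X).N o p) (ball (ctr k g U).1 (R' k))) ∧
      (∀ o ∈ ball (ctr k g U).1 (R' k), ∀ p, ‖(𝔊 k i X).N o p‖ ≤ N₀ k i X))
    (hq : ∀ k, ∀ g ∈ W, ∀ (U : C.BgB) (X : C.Dom), C.scale X = k → ∀ i,
      (∀ o ∈ ball (ctr k g U).1 (R' k),
        AEStronglyMeasurable (Function.uncurry ((𝔊 k i X).q o)) ((𝔊 k i X).lam.prod volume)) ∧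
      (∀ p v, DifferentiableOn ℂ (fun o => (𝔊 k i X).q o p v) (ball (ctr k g U).1 (R' k))) ∧
      (∀ o ∈ ball (ctr k g U).1 (R' k), ∀ p v, mq k i X * ‖v‖ ^ 2 - bq k i X ≤ ((𝔊 k i X).q o p v).re))
    {k : ℕ} {g : ℕ → ℝ} (hg : g ∈ W) {U : C.BgB} {h₀ v : B13HistM P} {μ₁ : ℝ}
    (hH : ‖h₀ - (ctr k g U).2‖ + μ₁ * ‖v‖ ≤ RHist k)
    {emb : D.Dom → C.Dom} (hscale : ∀ Z, C.scale (emb Z) = k) {terms : D.Dom → Finset ι} {act : Op × ℂ → D.Dom → ℂ}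
    (hact : ∀ p ∈ ball (ctr k g U).1 (ROp k) ×ˢ ball (0 : ℂ) μ₁, ∀ Z,
      act p Z = ∑ i ∈ terms Z, (𝔊 k i (emb Z)).termAt p.1 (h₀ + p.2 • v))
    {A R r₁ b₅ : ℝ} {X₀ : D.Dom} (hA : 0 ≤ A) (hr₁ : 0 ≤ r₁) (hb : r₁ * 5 ≤ b₅)
    (hrate : r₁ + 2 * G.κ₀ + 2 ≤ R) (hsmall : A * Real.exp (b₅ + 1) * G.K₀ * G.ν * G.c₁ ≤ 1)
    (hM3 : ∀ Z, G.cubes Z ⊆ G.cubes X₀ →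
      ∑ i ∈ terms Z, (𝔊 k i (emb Z)).lam.real univ * ((𝔊 k i (emb Z)).wB * N₀ k i (emb Z) *
          Real.exp (bq k i (emb Z))) * (Real.pi / (mq k i (emb Z) / 2)) ^ (Module.finrank ℝ (α k i) / 2 : ℝ) *
        Real.exp ((𝔊 k i (emb Z)).N₁ * (‖h₀‖ + μ₁ * ‖v‖)) ≤ A * Real.exp (-(R * D.dj Z))) :
    DifferentiableOn ℂ (fun p => locE G.ι G.cubes (act p) (G.cubes X₀)) (ball (ctr k g U).1 (ROp k) ×ˢ ball (0 : ℂ) μ₁) ∧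
      ∀ p ∈ ball (ctr k g U).1 (ROp k) ×ˢ ball (0 : ℂ) μ₁, ‖locE G.ι G.cubes (act p) (G.cubes X₀)‖ ≤
        Real.exp 1 * G.ν * G.c₁ * G.K₀ ^ 2 * A * Real.exp (-(r₁ * D.dj X₀)) := by
  haveI : Std.Refl G.ι := ⟨G.ι_refl⟩
  haveI : Std.Symm G.ι := ⟨G.ι_symm⟩
  set S : Set (Op × ℂ) := ball (ctr k g U).1 (ROp k) ×ˢ ball (0 : ℂ) μ₁ with hS
  have hSopen : IsOpen S := isOpen_ball.prod isOpen_ball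
  -- class points along the parameter: operator in the closed ball, table on the pencil
  have hKS : ∀ p ∈ S, (p.1, h₀ + p.2 • v) ∈ ballClass ctr ROp RHist k g U := fun p hp =>
    Set.mk_mem_prod (mem_closedBall.2 (le_of_lt (mem_ball.1 hp.1))) (mem_closedBall.2 (by
      rw [dist_eq_norm]
      have hs := mem_ball_zero_iff.1 hp.2
      calc ‖h₀ + p.2 • v - (ctr k g U).2‖ = ‖(h₀ - (ctr k g U).2) + p.2 • v‖ := by congr 1; abel
        _ ≤ ‖h₀ - (ctr k g U).2‖ + ‖p.2 • v‖ := norm_add_le _ _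
        _ ≤ ‖h₀ - (ctr k g U).2‖ + μ₁ * ‖v‖ := by rw [norm_smul]; gcongr
        _ ≤ RHist k := hH))
  have hball : ∀ p ∈ S, p.1 ∈ ball (ctr k g U).1 (R' k) := fun p hp =>
    mem_ball.2 ((mem_ball.1 hp.1).trans (hroom k))
  -- (E1): joint holomorphy of every term along `p ↦ (p.1, h₀ + p.2 • v)`
  have hE1 : ∀ Z, DifferentiableOn ℂ (fun p : Op × ℂ => act p Z) S := by
    intro Z
    have hterm : ∀ i, DifferentiableOn ℂ (fun p : Op × ℂ => (𝔊 k i (emb Z)).termAt p.1 (h₀ + p.2 • v)) S := by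
      intro i
      obtain ⟨hNm, hNh, hNb⟩ := hN k g hg U (emb Z) (hscale Z) i
      obtain ⟨hqm, hqh, hqre⟩ := hq k g hg U (emb Z) (hscale Z) i
      have hj := differentiableOn_termAt_joint (𝔊 k i (emb Z)) isOpen_ball (hm k g hg U (emb Z) (hscale Z) i) hNm hNh hNb
        hqm hqh hqre (‖h₀‖ + μ₁ * ‖v‖ + 1)
      refine hj.comp (differentiableOn_fst.prodMk ((differentiableOn_const h₀).add (differentiableOn_snd.smul_const v)))
        fun p hp => Set.mk_mem_prod (hball p hp) ?_
      rw [mem_ball_zero_iff]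
      exact lt_of_le_of_lt (norm_pencil_le hp.2) (lt_add_one _)
    exact (DifferentiableOn.fun_sum fun i _ => hterm i).congr fun p hp => hact p hp Z
  -- (E2): the o-uniform letter mass
  have hE2 : ∀ p ∈ S, ∀ Z, G.cubes Z ⊆ G.cubes X₀ → ‖act p Z‖ ≤
      ∑ i ∈ terms Z, (𝔊 k i (emb Z)).lam.real univ * ((𝔊 k i (emb Z)).wB * N₀ k i (emb Z) *
          Real.exp (bq k i (emb Z))) * (Real.pi / (mq k i (emb Z) / 2)) ^ (Module.finrank ℝ (α k i) / 2 : ℝ) *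
        Real.exp ((𝔊 k i (emb Z)).N₁ * (‖h₀‖ + μ₁ * ‖v‖)) := by
    intro p hp Z _
    refine norm_act_le_of_terms_biparam (termHistExpLinear_termAt 𝔊 hroom hm hN hq) hg (ho := fun p : Op × ℂ => p.1)
      (hc := fun p : Op × ℂ => h₀ + p.2 • v) hKS (fun p hp => norm_pencil_le hp.2) hscale hact
      (N := fun Z i => (𝔊 k i (emb Z)).N₁)
      (M := fun Z i => (𝔊 k i (emb Z)).lam.real univ * ((𝔊 k i (emb Z)).wB * N₀ k i (emb Z) *
        Real.exp (bq k i (emb Z))) * (Real.pi / (mq k i (emb Z) / 2)) ^ (Module.finrank ℝ (α k i) / 2 : ℝ))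
      (fun Z i => (𝔊 k i (emb Z)).N₁_nonneg)
      (fun p _ Z i _ => Filter.Eventually.of_forall fun z => (𝔊 k i (emb Z)).norm_readOut_le z.1 z.2)
      (fun p hp Z i _ => ?_) hp Z
    simpa only [one_mul] using norm_integral_coreDensity_le (𝔊 k i (emb Z)) (hm k g hg U (emb Z) (hscale Z) i)
      (hN k g hg U (emb Z) (hscale Z) i).2.2 (hq k g hg U (emb Z) (hscale Z) i).2.2 (hball p hp)
  exact analytic_and_bounded_locE_param G.ι hSopen G.loc G.reach_le D.dj_nonneg hA G.K₀_nonneg G.c₁_nonneg G.ν_nonneg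
    G.κ₀_nonneg hr₁ (by norm_num) hb G.ineq126 G.volBound (G.ineq227 X₀) hrate hsmall (G.cubes_nonempty X₀)
    (fun Z _ => hE1 Z) hE2 hM3

end Dep

/-! ## §5 AT THE SUBSTRATE'S LETTERS: the slot activities `actOfLetters ℓ`, jointly in (operator datum, source) -/

section Slot

variable {C : Carriers} (P : MeasPotFrame C) (Op : Type*) [NormedAddCommGroup Op] [NormedSpace ℂ Op] {Pol J : Type*}
  (𝒴 : Pol → J → Type) [∀ Z j, Fintype (𝒴 Z j)] (dom : ∀ Z j, 𝒴 Z j → C.Dom)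
  (Jc : Pol → J → Type) [∀ Z j, Fintype (Jc Z j)]
  (V : Pol → J → Type) [∀ Z j, NormedAddCommGroup (V Z j)] [∀ Z j, InnerProductSpace ℝ (V Z j)]
  [∀ Z j, MeasurableSpace (V Z j)] [∀ Z j, BorelSpace (V Z j)] [∀ Z j, FiniteDimensional ℝ (V Z j)]
variable (D : LocDomainSys) {Cube : Type} [DecidableEq Cube] (G : Geometry D Cube)

open Classical in
/-- **JOINT HOLOMORPHY IN (OPERATOR DATUM, SOURCE) + THE (2.41) ENVELOPE OF THE DRESSED OUTPUT OF THE SUBSTRATE'S SLOT ACTIVITIES**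
(kernel; §4 at the term index `Pol × J`, `𝔊 k p X := coreOf ℓ p.1 p.2`, dressed activity of the polymer `Z` at parameter `(o, s)` :=
`Σ_{p ∈ terms Z} actOfLetters ℓ p.1 p.2 o (h₀ + s • v)` — `hact` BY `rfl`).  Binders = N0r's `muPart_locE_le_of_actOfLetters` without the
window point and WITHOUT `hO`. [folklore] -/
theorem analytic_and_bounded_locE_opSource_of_actOfLetters {W : Set (ℕ → ℝ)} {ctr : ℕ → (ℕ → ℝ) → C.BgB → Op × B13HistM P}
    {ROp RHist R' : ℕ → ℝ} (ℓ : ∀ Z j, CoreLetters P Op 𝒴 dom Jc V Z j) {mq bq N₀ : ℕ → Pol × J → C.Dom → ℝ}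
    (hroom : ∀ k, ROp k < R' k)
    (hm : ∀ k, ∀ g ∈ W, ∀ (U : C.BgB) (X : C.Dom), C.scale X = k → ∀ p, 0 < mq k p X)
    (hN : ∀ k, ∀ g ∈ W, ∀ (U : C.BgB) (X : C.Dom), C.scale X = k → ∀ p : Pol × J,
      (∀ o ∈ ball (ctr k g U).1 (R' k),
        AEStronglyMeasurable ((ℓ p.1 p.2).N o) (coreOf P Op 𝒴 dom Jc V ℓ p.1 p.2).lam) ∧
      (∀ a, DifferentiableOn ℂ (fun o => (ℓ p.1 p.2).N o a) (ball (ctr k g U).1 (R' k))) ∧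
      (∀ o ∈ ball (ctr k g U).1 (R' k), ∀ a, ‖(ℓ p.1 p.2).N o a‖ ≤ N₀ k p X))
    (hq : ∀ k, ∀ g ∈ W, ∀ (U : C.BgB) (X : C.Dom), C.scale X = k → ∀ p : Pol × J,
      (∀ o ∈ ball (ctr k g U).1 (R' k),
        AEStronglyMeasurable (Function.uncurry ((ℓ p.1 p.2).q o))
          ((coreOf P Op 𝒴 dom Jc V ℓ p.1 p.2).lam.prod volume)) ∧
      (∀ a v, DifferentiableOn ℂ (fun o => (ℓ p.1 p.2).q o a v) (ball (ctr k g U).1 (R' k))) ∧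
      (∀ o ∈ ball (ctr k g U).1 (R' k), ∀ a v, mq k p X * ‖v‖ ^ 2 - bq k p X ≤ ((ℓ p.1 p.2).q o a v).re))
    {k : ℕ} {g : ℕ → ℝ} (hg : g ∈ W) {U : C.BgB} {h₀ v : B13HistM P} {μ₁ : ℝ}
    (hH : ‖h₀ - (ctr k g U).2‖ + μ₁ * ‖v‖ ≤ RHist k)
    {emb : D.Dom → C.Dom} (hscale : ∀ Z, C.scale (emb Z) = k) (terms : D.Dom → Finset (Pol × J))
    {A R r₁ b₅ : ℝ} {X₀ : D.Dom} (hA : 0 ≤ A) (hr₁ : 0 ≤ r₁) (hb : r₁ * 5 ≤ b₅)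
    (hrate : r₁ + 2 * G.κ₀ + 2 ≤ R) (hsmall : A * Real.exp (b₅ + 1) * G.K₀ * G.ν * G.c₁ ≤ 1)
    (hM3 : ∀ Z, G.cubes Z ⊆ G.cubes X₀ →
      ∑ p ∈ terms Z, (coreOf P Op 𝒴 dom Jc V ℓ p.1 p.2).lam.real univ *
          ((coreOf P Op 𝒴 dom Jc V ℓ p.1 p.2).wB * N₀ k p (emb Z) * Real.exp (bq k p (emb Z))) *
          (Real.pi / (mq k p (emb Z) / 2)) ^ (Module.finrank ℝ (V p.1 p.2) / 2 : ℝ) *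
        Real.exp ((coreOf P Op 𝒴 dom Jc V ℓ p.1 p.2).N₁ * (‖h₀‖ + μ₁ * ‖v‖)) ≤ A * Real.exp (-(R * D.dj Z))) :
    DifferentiableOn ℂ (fun z : Op × ℂ => locE G.ι G.cubes
        (fun Z => ∑ p ∈ terms Z, actOfLetters P Op 𝒴 dom Jc V ℓ p.1 p.2 z.1 (h₀ + z.2 • v)) (G.cubes X₀))
        (ball (ctr k g U).1 (ROp k) ×ˢ ball (0 : ℂ) μ₁) ∧
      ∀ z ∈ ball (ctr k g U).1 (ROp k) ×ˢ ball (0 : ℂ) μ₁, ‖locE G.ι G.cubes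
          (fun Z => ∑ p ∈ terms Z, actOfLetters P Op 𝒴 dom Jc V ℓ p.1 p.2 z.1 (h₀ + z.2 • v)) (G.cubes X₀)‖ ≤
        Real.exp 1 * G.ν * G.c₁ * G.K₀ ^ 2 * A * Real.exp (-(r₁ * D.dj X₀)) :=
  analytic_and_bounded_locE_opSource_of_coresAt_pencil_mass D G (ι := Pol × J)
    (fun (_ : ℕ) (p : Pol × J) (_ : C.Dom) => coreOf P Op 𝒴 dom Jc V ℓ p.1 p.2) hroom hm hN hq hg hH hscale
    (terms := terms)
    (act := fun z Z => ∑ p ∈ terms Z, actOfLetters P Op 𝒴 dom Jc V ℓ p.1 p.2 z.1 (h₀ + z.2 • v))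
    (fun _ _ _ => rfl) hA hr₁ hb hrate hsmall hM3

end Slot

end Summit.QuantumFields.BalabanUV.T4Continuum.NE1p.DressedJointAnalyticOnCores

end
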